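import Summits.Ventures.PercRepro.GenQTenEightGapT3
import Summits.Ventures.PercRepro.GenQTenEightGapT4
import Summits.Ventures.PercRepro.GenQTenEightGapT5
import Summits.Ventures.PercRepro.GenQTenEightGapT6
import Summits.Ventures.PercRepro.GenQTenEightGapT7

/-!
# PercRepro — the `(10, 8)` row: THE TYPE LAYER CLOSED MODULO ITS GAP (night-4, gen 19)
`highLayersEightResidue_of_gap : HighLayersEightResidual → HighLayersEightResidue` — every certified type case of the residue is a tree theorem (130 certificates, the five per-type assemblies), only the `137` gap cases of `typeGapEight` remain as the hypothesis.
-/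
namespace PercRepro.Night4

open Finset ThmH SixFour GenQ PerFlat Star NightThree ThmN

/-- **THE TYPE RESIDUE OF THE `(10, 8)` ROW REDUCES TO ITS PRECISE GAP**: `HighLayersEightResidue` (the `267` type cases) from `HighLayersEightResidual` (the `137` gap cases of `typeGapEight`, GenQTenEightGap) — Core → the seven hypotheses (`coreHyps_of_core`, `card_le_fCore_of_core` at ranks `6`, `7`), then the five per-type modules `GenQTenEightGapT3 … T7`, each of which discharges its `130` certified cases by their tree theorems `jq_t{t}_nonneg_c{d}_q8_m0`. -/
theorem highLayersEightResidue_of_gap (hres : HighLayersEightResidual) : HighLayersEightResidue := by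
  intro β _ M _ G hc hG hF hm t ht3 ht7 hlo hhi
  have h10 := core_flat_four_le_ten M hc
  obtain ⟨hs, hline, hplane, hsolid, hflat5⟩ := coreHyps_of_core hc h10
  have hflat6 : ∀ F ∈ flatsQ M 6, F.card ≤ 43 := fun F hF => (card_le_fCore_of_core hc h10 6 F hF).trans (by decide)
  have hflat7 : ∀ F ∈ flatsQ M 7, F.card ≤ 87 := fun F hF => (card_le_fCore_of_core hc h10 7 F hF).trans (by decide)
  have hG' := mem_flatsQ.1 hG
  unfold eightLargeBound at hhi
  interval_cases t <;> norm_num at hhi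
  · exact jq_t3_residue_eight_of_gap hres hs hline hplane hsolid hflat5 hflat6 hflat7 hc hG hF hG'.1 hG'.2.2 hm hlo hhi
  · exact jq_t4_residue_eight_of_gap hres hs hline hplane hsolid hflat5 hflat6 hflat7 hc hG hF hG'.1 hG'.2.2 hm hlo hhi
  · exact jq_t5_residue_eight_of_gap hres hs hline hplane hsolid hflat5 hflat6 hflat7 hc hG hF hG'.1 hG'.2.2 hm hlo hhi
  · exact jq_t6_residue_eight_of_gap hres hs hline hplane hsolid hflat5 hflat6 hflat7 hc hG hF hG'.1 hG'.2.2 hm hlo hhi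
  · exact jq_t7_residue_eight_of_gap hres hs hline hplane hsolid hflat5 hflat6 hflat7 hc hG hF hG'.1 hG'.2.2 hm hlo hhi

end PercRepro.Night4
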